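import Summits.AtomisticToContinuum.Crystallization.Theorems.FrustratedLawDichotomyStrainedPatchHomValueT2SoundK

/-!
# (I1) part L — ★ `mem_mkDRec`: the per-label derivative RECORD of the second-edition kit encloses the real data of the label (roadmap R3b, second half):
# `R.y ∋ (Vq)`, `R.d ∋ dyR`, `R.z ∋ ζ` (`zetaN`), `R.n ∋ ν` (`nuR`), for every self-map `V` with entries in `E` and argument `q` with components in `qI`
# (27623 `(H) HomFloor`, hcp half; decomp-a2c hand-1 g41; I1-ROADMAP-g41 §4 (iii)).

No definitions; 0 sorry; standard axioms; no instances / notation / `#eval`.  `--supports stmt-AtomisticToContinuum-27623`.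
-/

noncomputable section

namespace Summit.AtomisticToContinuum.Crystallization.Theorems.FrustratedLawDichotomyStrainedPatchHomValueT2Kit

open scoped BigOperators RealInnerProductSpace
open Finset
open Literature.Analysis.ValidatedNumerics.Numerics
open Summit.AtomisticToContinuum.Crystallization.Theorems.ChargedEnergyGapNegative (E3)
open Summit.AtomisticToContinuum.Crystallization.Theorems.FrustratedLawDichotomyStrainedPatchHomEntryGramHcp (dot3)

/-! ## §1. Reading the record's tables -/

/-- Reading the `dy` table. [formal bookkeeping] -/
theorem read_dy (top : ℕ) (E : Fin 3 × Fin 3 → FI) (qt : Fin 3 → FI) {a : ℕ} (ha : a < 9) (cc : Fin 3) :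
    (Array.ofFn fun n : Fin 27 => if n.val / 3 < top then d1 E qt (n.val / 3) ⟨n.val % 3, by omega⟩ else fi0).getD (3 * a + cc.val) fi0 =
      if a < top then d1 E qt a cc else fi0 := by
  have hcc := cc.isLt
  rw [getD_ofFn_lt _ _ (by omega : 3 * a + cc.val < 27)]
  have e1 : (3 * a + cc.val) / 3 = a := by omega
  have e2 : (3 * a + cc.val) % 3 = cc.val := by omega
  have e3 : ∀ (pf : (3 * a + cc.val) % 3 < 3), (⟨(3 * a + cc.val) % 3, pf⟩ : Fin 3) = cc := fun pf => Fin.ext e2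
  simp only [e1, e3]

/-- ★★ **THE RECORD ENCLOSES THE LABEL'S REAL DATA.**  For `mkDRec top E qI = some R` (`top ≤ 9`), a self-map `V` with entries in `E` and an argument `q`
with components in `qI`: the point `y = Vq`, the first derivatives `dyR` (`a < top`), the moments `ζ_k` (`k < top`) and `ν_kl` (`k, l < top`) lie in the
record's intervals. [folklore chaining] -/
theorem mem_mkDRec {top : ℕ} (htop : top ≤ 9) {E : Fin 3 × Fin 3 → FI} {qI : Fin 3 → FI} {R : DRec} (h : mkDRec top E qI = some R)
    (V : E3 →L[ℝ] E3) (q : E3) (hE : ∀ ab : Fin 3 × Fin 3, FI.mem ((V (EuclideanSpace.single ab.2 (1 : ℝ))) ab.1) (E ab))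
    (hq : ∀ c, FI.mem (q c) (qI c)) :
    (∀ cc : Fin 3, FI.mem ((V q) cc) (R.y cc)) ∧
    (∀ a, a < top → ∀ cc : Fin 3, FI.mem (dyR V q a cc) (R.d a cc.val)) ∧
    (∀ k, k < top → FI.mem (zetaN V q k) (R.z k)) ∧
    (∀ k l, k < top → l < top → FI.mem (nuR V q k l) (R.n k l)) := by
  -- unpack the record WITHOUT zeta-expanding the shared lets: after `split` they are local definitions `dy gd ze nu gz` (in this order), followed by the
  -- match scrutinee, `co` and the match equation; `pt rt` are extracted from the branch.  Never compare the arrays by `rfl`; read them through `getD_ofFn_lt`.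
  unfold mkDRec at h
  extract_lets qt y at h
  split at h
  · exact absurd h (by simp)
  rename_i dy gd ze nu gz xo co hco
  extract_lets pt rt at h
  simp only [Option.some.injEq] at h
  subst h
  -- the point
  have hqt : ∀ c, FI.mem (q c) (qt c) := fun c => by
    show FI.mem (q c) (tab3 qI c); rw [tab3_apply]; exact hq c
  have hy : ∀ cc : Fin 3, FI.mem ((V q) cc) (y cc) := fun cc => by
    show FI.mem ((V q) cc) (tab3 (yOf E qt) cc); rw [tab3_apply]; exact mem_yOf V q hE hqt cc
  -- the first derivatives (read through the `dy` table)
  have hd : ∀ a, a < top → ∀ (c : ℕ) (hc : c < 3), FI.mem (dyR V q a ⟨c, hc⟩) (gd a c) := by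
    intro a hat c hc
    show FI.mem (dyR V q a ⟨c, hc⟩)
      ((Array.ofFn fun n : Fin 27 => if n.val / 3 < top then d1 E qt (n.val / 3) ⟨n.val % 3, by omega⟩ else fi0).getD (3 * a + c) fi0)
    have := read_dy top E qt (by omega : a < 9) ⟨c, hc⟩
    rw [this, if_pos hat]
    exact mem_d1 V q hE hqt (by omega) ⟨c, hc⟩
  refine ⟨hy, fun a hat cc => hd a hat cc.val cc.isLt, ?_, ?_⟩
  · -- `R.z`
    intro k hk
    show FI.mem (zetaN V q k)
      ((Array.ofFn fun a : Fin 9 => if a.val < top then (((y 0).mul (gd a.val 0)).add ((y 1).mul (gd a.val 1))).add ((y 2).mul (gd a.val 2)) else fi0).getD k fi0)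
    rw [getD_ofFn_lt _ _ (by omega : k < 9)]
    dsimp only
    rw [if_pos hk, zetaN_eq_sum V q (by omega), Fin.sum_univ_three]
    exact FI.mem_add (FI.mem_add (FI.mem_mul (hy 0) (hd k hk 0 (by norm_num))) (FI.mem_mul (hy 1) (hd k hk 1 (by norm_num))))
      (FI.mem_mul (hy 2) (hd k hk 2 (by norm_num)))
  · -- `R.n` (symmetric storage); first the upper-triangle entry (read through the local definition `nu`, never restated)
    have hup : ∀ k l, k ≤ l → l < top → FI.mem (nuR V q k l) (nu.getD (9 * k + l) fi0) := by
      intro k l hkl hlt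
      have hk9 : k < 9 := by omega
      have hl9 : l < 9 := by omega
      have e1 : (9 * k + l) / 9 = k := by omega
      have e2 : (9 * k + l) % 9 = l := by omega
      simp only [nu]
      rw [getD_ofFn_lt _ _ (by omega : 9 * k + l < 81)]
      simp only [e1, e2, if_pos (And.intro hkl hlt)]
      unfold nuR
      rw [Finset.sum_add_distrib, Fin.sum_univ_three, Fin.sum_univ_three]
      refine FI.mem_add (FI.mem_add (FI.mem_add (FI.mem_mul (hd k (by omega) 0 (by norm_num)) (hd l hlt 0 (by norm_num)))
        (FI.mem_mul (hd k (by omega) 1 (by norm_num)) (hd l hlt 1 (by norm_num)))) (FI.mem_mul (hd k (by omega) 2 (by norm_num)) (hd l hlt 2 (by norm_num)))) ?_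
      rw [← d2_cast hk9 hl9 0, ← d2_cast hk9 hl9 1, ← d2_cast hk9 hl9 2]
      exact FI.mem_add (FI.mem_add (FI.mem_mulInt (hy 0) _) (FI.mem_mulInt (hy 1) _)) (FI.mem_mulInt (hy 2) _)
    intro k l hk hl
    simp only [DRec.n]
    unfold sIx
    by_cases hkl : k ≤ l
    · rw [if_pos hkl]; exact hup k l hkl hl
    · rw [if_neg hkl, nuR_symm V q k l]; exact hup l k (by omega) hk

end Summit.AtomisticToContinuum.Crystallization.Theorems.FrustratedLawDichotomyStrainedPatchHomValueT2Kit
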